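import Literature.AlgebraicGeometry.Resolution.WeightedOrderCoordinateChangesIndexed
import HarnessLib

/-!
# (K-Φ3) label propagation I: the vertex `v = (α, β)` of Hironaka's polygon with a block of `r` y-variables is invariant under a
# first-order perturbation of the frame (expansion-free core of CJS Lemma 13.6 / Thm. 8.16 in embedding dimension `r + 2`)

Cell `res-dim4-pi` (D-0157 DOOR 2), Φ = β_h line of CARD I-1-6 / I-1-7 / I-1-8 (res-dim4-idea-1), kernel target (K-Φ3) of the signature
sketch `pub/res-dim4/res-dim4-idea-1/lean-g5/Sketch.lean` (ade7af20c994a8b6): in `PhiLine.keepCount_add_betaS_le` the STEP frame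
`s k` and the ARRIVAL frame `a k` of the `k`-th state are related by the binders `hgens`, `hne`, `hδ` and
`hsa : betaS (s k) (J k) μ ≤ betaS (a k) (J k) μ`. The step frame arises from the arrival frame by the TWIST `ũ₂ = u₂ − φ u₁` (LOSE-h,
CJS Lemma 12.6 / 13.6; memo `pub/res-dim4/res-dim4-idea-1/B-infinity-critical-frame.md` §6.2 (P3)) and by DISSOLUTIONS `y ↦ y + λ u^w` of
lattice points `w` to the right of the column of `v` (§6.2 (P4)(i) «column safety», (C5); after RUN-1c / §6.8 and idea-1 g6's I-1-8 plan:
only the single `(2,0)`-dissolution of a CARRIED label). Both are FIRST-ORDER PERTURBATIONS of the frame for every steep level weight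
through `v`, and this file proves the common core, for EVERY `r` (the cell uses `r = 2`, `R = 𝒪_{𝔸⁴,0}`), in the indexed polygon
vocabulary of `PolygonInvariantsIndexed` / `WeightedOrderCoordinateChangesIndexed` (`c : Fin (r + 2) → R`):

* generic substitution estimates for two families `c, c′ : σ → R` with `c_i − c′_i ∈ F_{w_i + 1}(c)`:
  `mul_sub_mul_mem_weightedOrderIdeal`, `pow_sub_pow_mem_weightedOrderIdeal`, `cmonom_sub_cmonom_mem_weightedOrderIdeal`,
  `eval_sub_eval_mem_weightedOrderIdeal` (a `w`-homogeneous `G` of weight `n` has `G(c) − G(c′) ∈ F_{n+1}(c)`),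
  **`isInitialTerm_of_forall_sub_mem`** (initial unit terms transfer when moreover the `w`-weighted order ideals agree);
* steep supporting lines of the indexed polygon (ported from the `Fin 3` file `FacePreparation.lean`): `forall_pts_steepLine`,
  `eq_v_of_steepLine`, `alphaS_betaS_eq_of_steepLines` (any threshold `N₀` of slopes);
* **the vertex under a first-order perturbation**: `levelWeight_steep_pos`, `forall_pts_steepLine_of_weightedOrderIdeal_eq`,
  `exists_pts_v_of_forall_sub_mem`, **`alphaS_betaS_eq_of_forall_sub_mem`** — if the steep weighted order ideals of slopes
  `N ≥ N₀ > βs` agree for `c, c′` and `c − c′` is of higher order for the slope `N₀`, then `pts c′ ≠ ∅`, `αs′ = αs`, `βs′ = βs`.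

The instances (shear: `hsa` with equality, `hδ`, `hne`, `hgens`; dissolution right of the column) are the next file
`…PhiLineFrameMoves`. [OURS · counted 0 · AI work weaker than expert review.] Nothing here proves K2(p), `NoAboveFloorTrap`, the β_h line,
or resolution of singularities in dimension ≥ 4 / characteristic p.

Sources: V. Cossart, U. Jannsen, S. Saito, LNM **2270** (2020), Def. 11.1, Lemma 8.3 (4), Lemma 13.6, Thm. 8.16 [`CossartJannsenSaito2020`];
V. Cossart, O. Piltant, J. Algebra 320 (2008), proof of Lemma 4.5 (2), pp. 11–12 [`CossartPiltant2008`]. Tree: `Literature/AlgebraicGeometry/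
Resolution/PolygonShear.lean`, `FacePreparation.lean` (the `r = 1` statements generalised here).
-/

noncomputable section

open IsLocalRing MvPolynomial
open Literature.AlgebraicGeometry.Resolution (cmonom cmonom_add cmonom_zero cmonom_single_pow eval_monomial_eq_cmonom
  weightedOrderIdeal weightedOrderIdeal_antitone weightedOrderIdeal_mul_le weightedOrderIdeal_pow_le apply_mem_weightedOrderIdeal)
open Literature.AlgebraicGeometry.Resolution.WeightedOrder

set_option linter.dupNamespace false

namespace Summit.ResolutionOfSingularities.ResolutionOfSingularities.Theorems.PIDim4.PhiLine

universe u v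

/-! ## Generic substitution estimates: two families that agree to first weighted order -/

section Generic

variable {R : Type u} [CommRing R] {σ : Type v} (c c' : σ → R) (w : σ → ℕ)

/-- `a b − a′ b′ ∈ F_{ρ_a + ρ_b + 1}` when `a ∈ F_{ρ_a}`, `b′ ∈ F_{ρ_b}`, `a − a′ ∈ F_{ρ_a + 1}`, `b − b′ ∈ F_{ρ_b + 1}`
(`a b − a′ b′ = a (b − b′) + (a − a′) b′`). [cite: CossartJannsenSaito2020, Def. 7.2 (1)] -/
theorem mul_sub_mul_mem_weightedOrderIdeal {a a' b b' : R} {ρa ρb : ℕ} (ha : a ∈ weightedOrderIdeal c w ρa)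
    (hb' : b' ∈ weightedOrderIdeal c w ρb) (hda : a - a' ∈ weightedOrderIdeal c w (ρa + 1))
    (hdb : b - b' ∈ weightedOrderIdeal c w (ρb + 1)) : a * b - a' * b' ∈ weightedOrderIdeal c w (ρa + ρb + 1) := by
  have hsplit : a * b - a' * b' = a * (b - b') + (a - a') * b' := by ring
  rw [hsplit]
  refine Ideal.add_mem _ ?_ ?_
  · exact weightedOrderIdeal_antitone c w (by omega) (weightedOrderIdeal_mul_le c w _ _ (Ideal.mul_mem_mul ha hdb))
  · exact weightedOrderIdeal_antitone c w (by omega) (weightedOrderIdeal_mul_le c w _ _ (Ideal.mul_mem_mul hda hb'))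

/-- `a^k − a′^k ∈ F_{kρ + 1}` when `a ∈ F_ρ` and `a − a′ ∈ F_{ρ+1}`. [cite: CossartJannsenSaito2020, Def. 7.2 (1)] -/
theorem pow_sub_pow_mem_weightedOrderIdeal {a a' : R} {ρ : ℕ} (ha : a ∈ weightedOrderIdeal c w ρ)
    (hda : a - a' ∈ weightedOrderIdeal c w (ρ + 1)) :
    ∀ k : ℕ, a ^ k - a' ^ k ∈ weightedOrderIdeal c w (k * ρ + 1)
  | 0 => by rw [pow_zero, pow_zero, sub_self]; exact Ideal.zero_mem _
  | k + 1 => by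
    have ha' : a' ∈ weightedOrderIdeal c w ρ := by
      have h := Ideal.sub_mem _ ha (weightedOrderIdeal_antitone c w (Nat.le_succ ρ) hda)
      rwa [sub_sub_cancel] at h
    have hk : a ^ k ∈ weightedOrderIdeal c w (k * ρ) := weightedOrderIdeal_pow_le c w ρ k (Ideal.pow_mem_pow ha k)
    have h := mul_sub_mul_mem_weightedOrderIdeal c w hk ha' (pow_sub_pow_mem_weightedOrderIdeal ha hda k) hda
    rw [pow_succ, pow_succ]
    refine weightedOrderIdeal_antitone c w (le_of_eq ?_) h
    ring

/-- **Monomials of two families agreeing to first weighted order**: if `c_i − c′_i ∈ F_{w_i + 1}(c)` for every `i`, then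
`c^e − c′^e ∈ F_{⟨w, e⟩ + 1}(c)` for every exponent `e`. [cite: CossartJannsenSaito2020, Def. 7.2 (1)] -/
theorem cmonom_sub_cmonom_mem_weightedOrderIdeal (h : ∀ i, c i - c' i ∈ weightedOrderIdeal c w (w i + 1)) (e : σ →₀ ℕ) :
    cmonom c e - cmonom c' e ∈ weightedOrderIdeal c w (Finsupp.weight w e + 1) := by
  classical
  have h₀ : ∀ i, c' i ∈ weightedOrderIdeal c w (w i) := by
    intro i
    have hi := Ideal.sub_mem _ (apply_mem_weightedOrderIdeal c w i) (weightedOrderIdeal_antitone c w (Nat.le_succ _) (h i))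
    rwa [sub_sub_cancel] at hi
  induction e using Finsupp.induction with
  | zero => rw [cmonom_zero, cmonom_zero, sub_self]; exact Ideal.zero_mem _
  | single_add i b f _ _ ih =>
    rw [cmonom_add, cmonom_add, cmonom_single_pow, cmonom_single_pow, map_add]
    have hpow := pow_sub_pow_mem_weightedOrderIdeal c w (apply_mem_weightedOrderIdeal c w i) (h i) b
    have hci : c i ^ b ∈ weightedOrderIdeal c w (b * w i) :=
      weightedOrderIdeal_pow_le c w (w i) b (Ideal.pow_mem_pow (apply_mem_weightedOrderIdeal c w i) b)
    have hf' : cmonom c' f ∈ weightedOrderIdeal c w (Finsupp.weight w f) :=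
      cmonom_mem_weightedOrderIdeal_of_forall_apply_mem c c' w h₀ f
    have hm := mul_sub_mul_mem_weightedOrderIdeal c w hci hf' hpow ih
    refine weightedOrderIdeal_antitone c w (le_of_eq ?_) hm
    rw [Finsupp.weight_apply, Finsupp.sum_single_index (by simp), smul_eq_mul]

/-- **Substitution estimate**: for `G` `w`-homogeneous of weight `n` and two families with `c_i − c′_i ∈ F_{w_i + 1}(c)`,
`G(c) − G(c′) ∈ F_{n+1}(c)` (the general form of `PolygonShear`'s `eval_sub_eval_shiftU₂_mem`). [cite: CossartJannsenSaito2020, Lemma 13.6] -/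
theorem eval_sub_eval_mem_weightedOrderIdeal (h : ∀ i, c i - c' i ∈ weightedOrderIdeal c w (w i + 1)) {n : ℕ}
    {G : MvPolynomial σ R} (hG : G.IsWeightedHomogeneous w n) :
    eval c G - eval c' G ∈ weightedOrderIdeal c w (n + 1) := by
  classical
  rw [G.as_sum, map_sum, map_sum, ← Finset.sum_sub_distrib]
  refine Ideal.sum_mem _ fun m hm => ?_
  rw [eval_monomial_eq_cmonom, eval_monomial_eq_cmonom, ← mul_sub]
  refine Ideal.mul_mem_left _ _ ?_
  have hwm : Finsupp.weight w m = n := hG (mem_support_iff.mp hm)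
  rw [← hwm]
  exact cmonom_sub_cmonom_mem_weightedOrderIdeal c c' w h m

/-- Initial unit terms transfer between two families with `c_i − c′_i ∈ F_{w_i+1}(c)` and the SAME weighted order ideals.
[cite: CossartJannsenSaito2020, Def. 8.2] -/
theorem isInitialTerm_of_forall_sub_mem (h : ∀ i, c i - c' i ∈ weightedOrderIdeal c w (w i + 1))
    (hF : ∀ ρ, weightedOrderIdeal c' w ρ = weightedOrderIdeal c w ρ) {f : R} {e : σ →₀ ℕ} (he : IsInitialTerm c w f e) :
    IsInitialTerm c' w f e := by
  obtain ⟨F, hF₁, hFu, hrem⟩ := he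
  refine ⟨F, hF₁, hFu, ?_⟩
  rw [hF]
  have hsplit : f - eval c' F = (f - eval c F) + (eval c F - eval c' F) := by ring
  rw [hsplit]
  exact Ideal.add_mem _ hrem (eval_sub_eval_mem_weightedOrderIdeal c c' w h hF₁)

end Generic

/-! ## Steep supporting lines of the indexed polygon (ported from `FacePreparation.lean`) -/

section Steep

variable {R : Type u} [CommRing R] {r : ℕ} {c : Fin (r + 2) → R} {J : Ideal R} {μ : ℕ}

/-- **Steep lines support the polygon** (indexed polygon, `c : Fin (r + 2) → R`): `N αs + βs ≤ N x₁ + x₂` on `pts` for every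
slope `N > βs`. [cite: CossartJannsenSaito2020, Def. 11.1] -/
theorem forall_pts_steepLine {N : ℕ} (hN : betaS c J μ < N) :
    ∀ e ∈ pts c J μ, N * alphaS c J μ + betaS c J μ ≤ N * spt₁ μ e + 1 * spt₂ μ e := by
  intro e he
  rw [one_mul]
  have hα := alphaS_le he
  rcases hα.eq_or_lt with heq | hlt
  · have hβ := betaS_le he heq.symm
    rw [heq]; omega
  · have h1 : alphaS c J μ + 1 ≤ spt₁ μ e := hlt
    have := Nat.mul_le_mul_left N h1
    rw [Nat.mul_add, mul_one] at this
    omega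

/-- On a steep line through `v`, the only point of the polygon is `v`. [cite: CossartJannsenSaito2020, Def. 11.1] -/
theorem eq_v_of_steepLine {N : ℕ} (hN : betaS c J μ + 1 ≤ N) {e : Fin (r + 2) →₀ ℕ} (he : e ∈ pts c J μ)
    (h : N * spt₁ μ e + 1 * spt₂ μ e = N * alphaS c J μ + betaS c J μ) :
    spt₁ μ e = alphaS c J μ ∧ spt₂ μ e = betaS c J μ := by
  rw [one_mul] at h
  have hα := alphaS_le he
  rcases hα.eq_or_lt with heq | hlt
  · have hβ := betaS_le he heq.symm
    rw [← heq] at h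
    exact ⟨heq.symm, by omega⟩
  · exfalso
    have h1 : alphaS c J μ + 1 ≤ spt₁ μ e := hlt
    have := Nat.mul_le_mul_left N h1
    rw [Nat.mul_add, mul_one] at this
    omega

/-- **Recovering `α, β` from a family of steep lines**: if the steep lines `N x₁ + x₂ ≥ N αs + βs` of `c` are valid on `pts c⋆`
for ALL slopes `N ≥ N₀` (any threshold `N₀`), and `pts c⋆` contains a point at `(αs, βs)`, then `αs⋆ = αs` and `βs⋆ = βs` (`c⋆` may
live over another index type / ring / ideal). [cite: CossartJannsenSaito2020, Def. 11.1] -/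
theorem alphaS_betaS_eq_of_steepLines {R' : Type u} [CommRing R'] {r' : ℕ} {c' : Fin (r' + 2) → R'} {J' : Ideal R'} {N₀ : ℕ}
    (hS : ∀ N, N₀ ≤ N → ∀ e ∈ pts c' J' μ, N * alphaS c J μ + betaS c J μ ≤ N * spt₁ μ e + 1 * spt₂ μ e)
    {ev : Fin (r' + 2) →₀ ℕ} (hev : ev ∈ pts c' J' μ) (hev1 : spt₁ μ ev = alphaS c J μ) (hev2 : spt₂ μ ev = betaS c J μ) :
    alphaS c' J' μ = alphaS c J μ ∧ betaS c' J' μ = betaS c J μ := by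
  have hne' : (pts c' J' μ).Nonempty := ⟨ev, hev⟩
  have hlow : ∀ x ∈ pts c' J' μ, alphaS c J μ ≤ spt₁ μ x ∧ (spt₁ μ x = alphaS c J μ → betaS c J μ ≤ spt₂ μ x) := by
    intro x hx
    constructor
    · by_contra hlt
      push Not at hlt
      set N := N₀ + betaS c J μ + spt₂ μ x + 1 with hN
      have h := hS N (by omega) x hx
      rw [one_mul] at h
      have h1 : spt₁ μ x + 1 ≤ alphaS c J μ := hlt
      have := Nat.mul_le_mul_left N h1
      rw [Nat.mul_add, mul_one] at this
      omega
    · intro hx1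
      have h := hS N₀ le_rfl x hx
      rw [hx1, one_mul] at h
      omega
  have hα : alphaS c' J' μ = alphaS c J μ := by
    refine le_antisymm ?_ ?_
    · rw [← hev1]; exact alphaS_le hev
    · obtain ⟨a, ha, ha1⟩ := exists_pts_alphaS hne'
      rw [← ha1]; exact (hlow a ha).1
  refine ⟨hα, le_antisymm ?_ ?_⟩
  · rw [← hev2]; exact betaS_le hev (by rw [hev1, hα])
  · obtain ⟨b, hb, hb1, hb2⟩ := exists_pts_v hne'
    rw [← hb2]; exact (hlow b hb).2 (by rw [hb1, hα])

end Steep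

/-! ## The vertex under a first-order perturbation of the frame (generic in the new frame `c′`) -/

section Perturb

variable {R : Type u} [CommRing R] [IsRegularLocalRing R] {r : ℕ} (c c' : Fin (r + 2) → R)
  (hgen : Ideal.span (Set.range c) = maximalIdeal R) (hdim : ringKrullDim R = r + 2)
  (hgen' : Ideal.span (Set.range c') = maximalIdeal R) {J : Ideal R} {μ : ℕ}

/-- The level weight `(Nαs + βs, …, L N, L)` of the steep line of slope `N` through the vertex `v` of `(J, μ)` in the frame `c`.
[cite: CossartJannsenSaito2020, Def. 11.1] -/
theorem levelWeight_steep_pos (hgen : Ideal.span (Set.range c) = maximalIdeal R) (hdim : ringKrullDim R = r + 2)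
    (hJμ : J ≤ maximalIdeal R ^ μ) (hne : (pts c J μ).Nonempty) {N : ℕ} (hN : 0 < N) :
    0 < N * alphaS c J μ + betaS c J μ := by
  obtain ⟨e₀, he₀, h1₀, h2₀⟩ := exists_pts_v hne
  have hL := factorial_le_spt_add c hgen hdim hJμ he₀
  have : alphaS c J μ ≤ N * alphaS c J μ := Nat.le_mul_of_pos_left _ hN
  have := Nat.factorial_pos μ
  omega

include hgen hdim hgen' in
/-- **Steep half-planes transfer to a frame with the same steep weighted order ideals**: if the weighted order ideals of `c` and `c′`
for the steep level weight of slope `N` through `v` agree, the steep line `N x₁ + x₂ ≥ N αs + βs` (valid on `pts c`) is valid on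
`pts c′` (bridge `le_weightedOrderIdeal_levelWeight_iff` on both sides). [cite: CossartJannsenSaito2020, Remark 8.9 (2)] -/
theorem forall_pts_steepLine_of_weightedOrderIdeal_eq (hJμ : J ≤ maximalIdeal R ^ μ) (hne : (pts c J μ).Nonempty) {N : ℕ}
    (hN : betaS c J μ < N)
    (hA : ∀ ρ, weightedOrderIdeal c' (levelWeight μ (N * alphaS c J μ + betaS c J μ) N 1) ρ =
      weightedOrderIdeal c (levelWeight μ (N * alphaS c J μ + betaS c J μ) N 1) ρ) :
    ∀ e ∈ pts c' J μ, N * alphaS c J μ + betaS c J μ ≤ N * spt₁ μ e + 1 * spt₂ μ e := by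
  have hNpos : 0 < N := by omega
  have hw₀ := levelWeight_steep_pos c hgen hdim hJμ hne hNpos
  have h1 := (le_weightedOrderIdeal_levelWeight_iff c hgen hdim J hw₀ hNpos Nat.one_pos).mpr (forall_pts_steepLine hN)
  rw [← hA] at h1
  exact (le_weightedOrderIdeal_levelWeight_iff c' hgen' hdim J hw₀ hNpos Nat.one_pos).mp h1

include hgen hdim in
/-- **The vertex point survives a first-order perturbation of the frame**: if, for the steep level weight `w` of slope `N > βs`
through `v`, the new frame satisfies `c_i − c′_i ∈ F_{w_i + 1}(c)` and has the same `w`-weighted order ideals, then some Newton point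
of `(J, μ)` in the frame `c′` sits at `(α, β)` of `c` (`J ⊆ 𝔪^μ`, non-empty polygon) — the vertex point is an initial unit term for `w`
(`isInitialTerm_levelWeight_of_isMinOn`) and such terms transfer (`isInitialTerm_of_forall_sub_mem`).
[cite: CossartJannsenSaito2020, Lemma 8.3 (4)] -/
theorem exists_pts_v_of_forall_sub_mem (hJμ : J ≤ maximalIdeal R ^ μ) (hne : (pts c J μ).Nonempty) {N : ℕ} (hN : betaS c J μ < N)
    (hA : ∀ ρ, weightedOrderIdeal c' (levelWeight μ (N * alphaS c J μ + betaS c J μ) N 1) ρ =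
      weightedOrderIdeal c (levelWeight μ (N * alphaS c J μ + betaS c J μ) N 1) ρ)
    (hB : ∀ i, c i - c' i ∈ weightedOrderIdeal c (levelWeight μ (N * alphaS c J μ + betaS c J μ) N 1)
      (levelWeight (r := r) μ (N * alphaS c J μ + betaS c J μ) N 1 i + 1)) :
    ∃ e ∈ pts c' J μ, spt₁ μ e = alphaS c J μ ∧ spt₂ μ e = betaS c J μ := by
  obtain ⟨e, he, h1, h2⟩ := exists_pts_v hne
  have hNpos : 0 < N := by omega
  have hmin : ∀ x ∈ pts c J μ, N * spt₁ μ e + 1 * spt₂ μ e ≤ N * spt₁ μ x + 1 * spt₂ μ x := by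
    intro x hx
    have h := forall_pts_steepLine (c := c) (J := J) (μ := μ) hN x hx
    rw [h1, h2]
    omega
  have hw₀ : N * spt₁ μ e + 1 * spt₂ μ e = N * alphaS c J μ + betaS c J μ := by rw [h1, h2, one_mul]
  have hpos : 0 < N * spt₁ μ e + 1 * spt₂ μ e := by rw [hw₀]; exact levelWeight_steep_pos c hgen hdim hJμ hne hNpos
  obtain ⟨⟨f, hfJ, w, hw, hinit⟩, he₀⟩ := he
  have hinit' := isInitialTerm_levelWeight_of_isMinOn c hgen hdim hNpos Nat.one_pos ⟨⟨f, hfJ, w, hw, hinit⟩, he₀⟩ hmin hpos hfJ hw hinit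
  rw [hw₀] at hinit'
  refine ⟨e, ⟨⟨f, hfJ, _, levelWeight_pos (hw₀ ▸ hpos) hNpos Nat.one_pos, isInitialTerm_of_forall_sub_mem c c' _ hB hA hinit'⟩, he₀⟩,
    h1, h2⟩

include hgen hdim hgen' in
/-- **The vertex `v = (α, β)` is invariant under a first-order perturbation of the frame.** Let `c′` generate `𝔪` and let `N₀ > βs`.
If for every slope `N ≥ N₀` the steep weighted order ideals of `c` and `c′` agree (`hA`), and for the slope `N₀` moreover
`c_i − c′_i ∈ F_{w_i + 1}(c)` (`hB`), then the polygon of `(J, μ)` in the frame `c′` is non-empty with the same `αs`, `βs`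
(`J ⊆ 𝔪^μ`). Instances: the shear `u₂ ↦ u₂ + λ u₁` (below) and the dissolution of a lattice point strictly right of the column of `v`
(file `…PhiLineDissolution`). [cite: CossartJannsenSaito2020, Lemma 13.6] [cite: CossartJannsenSaito2020, Thm. 8.16] -/
theorem alphaS_betaS_eq_of_forall_sub_mem (hJμ : J ≤ maximalIdeal R ^ μ) (hne : (pts c J μ).Nonempty) {N₀ : ℕ}
    (hN₀ : betaS c J μ < N₀)
    (hA : ∀ N, N₀ ≤ N → ∀ ρ, weightedOrderIdeal c' (levelWeight μ (N * alphaS c J μ + betaS c J μ) N 1) ρ =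
      weightedOrderIdeal c (levelWeight μ (N * alphaS c J μ + betaS c J μ) N 1) ρ)
    (hB : ∀ i, c i - c' i ∈ weightedOrderIdeal c (levelWeight μ (N₀ * alphaS c J μ + betaS c J μ) N₀ 1)
      (levelWeight (r := r) μ (N₀ * alphaS c J μ + betaS c J μ) N₀ 1 i + 1)) :
    (pts c' J μ).Nonempty ∧ alphaS c' J μ = alphaS c J μ ∧ betaS c' J μ = betaS c J μ := by
  obtain ⟨e, he, h1, h2⟩ := exists_pts_v_of_forall_sub_mem c c' hgen hdim hJμ hne hN₀ (hA N₀ le_rfl) hB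
  exact ⟨⟨e, he⟩, alphaS_betaS_eq_of_steepLines (c := c) (c' := c') (N₀ := N₀)
    (fun N hN => forall_pts_steepLine_of_weightedOrderIdeal_eq c c' hgen hdim hgen' hJμ hne (by omega) (hA N hN)) he h1 h2⟩

end Perturb

end Summit.ResolutionOfSingularities.ResolutionOfSingularities.Theorems.PIDim4.PhiLine

end
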